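import Summits.QuantumFields.BalabanUV.Beta.GAN24.FineReadoutCauchyFrame
import Summits.QuantumFields.BalabanUV.Beta.GAN24.AliasNest
import Summits.QuantumFields.BalabanUV.Beta.GAN24.AliasWeights

/-!
# `BalabanUV.Beta.GAN24.FineReadoutCauchyFold` — «(N1-Cauchy)» PART N: the cell sum FOLDS the next level's aliases onto this level's; the difference symbol alias by alias

**G-an2-4 FORMALISATION SWARM, b2b-balaban-gan24-formalise-leaf-17 (gen 11) — PART N of the located leaf «(N1-Cauchy)»** (owner's spec
`N1-CAUCHY-SPEC.md` §3(b) «cell mean = alias folding», made literal; division `HOME/b2b-balaban-gan24-formalise-leaf-17/g11/N1-CAUCHY-DIVISION.md`).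
NOT IN PRINT; OUR PROOF ATTEMPT.  [folklore] finite Fourier bookkeeping, no analysis.

HONEST FRAMING (verbatim): «discharging `BetaPertH` makes Bałaban's UV stability UNCONDITIONAL — a real constructive-QFT result;
it is NOT the continuum limit and NOT the Clay problem.»
HONEST DEPENDENCY (verbatim): «continuum YM on T⁴ ⇐ BetaPertH ∧ nine spine estimates (0/9 proved); BetaPertH ⇐ (D1) ∧ (D4) ∧ CAP+tail;
G-an2-4 gates asym, D1 and NE2/3/4.»

## What is here
* §1 `boxW Lc k = Σ_{r ∈ box Lc} pw k r = Π_i gs (k_i) Lc` (the plane wave summed over one cell; `AliasWeights.geomExp_mul_sub_one` BY NAME).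
* §2 cell arithmetic: `repZ (proj (N·Lc) (Lc•z + r)) = Lc•repZ (proj N z) + r` (`repZ_proj_cell`), `pw k (c•x) = pw (c·k) x`, `2π`-integer
  shifts of the momentum are invisible at integer sites, and **`pw_kFine_nest_zsmul`**: `pw (kFine_{N′} p (nest N′ N m t)) (Lc•ζ) = pw (kFine_N p m) ζ`
  (`Lc·k′ = k_m + 2π t`, `AliasNest.natCast_mul_kAl_nest`).
* §3 **`cellSum_eq_sum_fold`** and **`diffSym_eq_sum_fold`**: given ANY per-alias expansions of the columns at the two levels
  (`(F_N⁻¹)_{(κ,ζ),(Q,l)}(p) = Σ_m Amp(m,κ)·pw (k_m) (repZ ζ)` — leaf-16's `FineReadoutColumn.fibInv_inl_inr_eq_sum_Asol` provides them),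
  `diffSym N N′ Lc κ l z p = Σ_{m ∈ (ℤ/N)^{d+1}} [(Lc^{d+1})⁻¹·N′^{d+2}·Σ_{t ∈ (ℤ/Lc)^{d+1}} boxW Lc (k′_{nest m t})·Amp′(nest m t, κ) − N^{d+2}·Amp(m, κ)]·pw (k_m) (repZ (proj N z))`
  — the two levels are compared ALIAS BY ALIAS at level `N`, the `Lc^{d+1}` sub-aliases `nest m t` of `m` weighted by their box weights.
* §4 KEY STRUCTURE **`gs_kFine_nest_mul_dhat`**: `gs (k′_i) Lc · dhat k′ i = dhat k_m i` — in a coordinate with `t_i = 0` the box factor is the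
  matched weight, in a coordinate with `t_i ≠ 0` it equals `dhat(k_m)_i / dhat(k′)_i = O(|k_{m,i}|)`: ONE lattice derivative gained (the input
  of division PARTS A and K); `boxW_nest_mul_prod_dhat` is the product form.
Discharges NOTHING of `(hS, hSall)`.  0 sorry, axioms {propext, Classical.choice, Quot.sound}.
-/

noncomputable section

open Complex Finset
open scoped Real BigOperators
open Literature.MathematicalPhysics.QuantumFieldTheory
open Literature.MathematicalPhysics.QuantumFieldTheory.Balaban1983to89
open Literature.MathematicalPhysics.QuantumFieldTheory.Balaban1983to89.Beta
open Literature.Probability.LatticeModels (Site TorusSite Torus.proj)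
open LatticeForm (repZ quo)
open BlochFibreMatrix (Idx)
open AffineAveraging (box toSite)
open Summit.QuantumFields.BalabanUV.Beta.GAN24.CombesThomasFibre (fibInv)
open Summit.QuantumFields.BalabanUV.Beta.GAN24.FibreSymbols (pw dhat pw_add pw_toSite)
open Summit.QuantumFields.BalabanUV.Beta.GAN24.FibreDFT (kFine)
open Summit.QuantumFields.BalabanUV.Beta.GAN24.AliasObjects (gs kAl)
open Summit.QuantumFields.BalabanUV.Beta.GAN24.AliasNest (nest sum_nest natCast_mul_kAl_nest)
open Summit.QuantumFields.BalabanUV.Beta.GAN24.AliasWeights (geomExp_mul_sub_one)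
open Summit.QuantumFields.BalabanUV.Beta.GAN24.FineReadoutCauchyFrame (diffSym toSite_mem_range)

namespace Summit.QuantumFields.BalabanUV.Beta.GAN24.FineReadoutCauchyFold

variable {d : ℕ}

/-! ## §1 The box weight of a fine momentum -/

/-- [folklore] **The box weight** `boxW Lc k = Σ_{r ∈ box Lc} e^{i k·r}` — the plane wave summed over one `Lc`-cell. -/
def boxW (Lc : ℕ) (k : Fin (d + 1) → ℂ) : ℂ := ∑ r ∈ box (d + 1) Lc, pw k (toSite r)

/-- [folklore] The box weight factorises into one-dimensional geometric sums: `boxW Lc k = Π_i gs (k_i) Lc`. -/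
theorem boxW_eq_prod (Lc : ℕ) (k : Fin (d + 1) → ℂ) : boxW Lc k = ∏ i, gs (k i) Lc := by
  unfold boxW gs AffineAveraging.box
  rw [Finset.prod_univ_sum]
  refine Finset.sum_congr rfl fun r _ => ?_
  rw [pw_toSite]

/-! ## §2 Cell arithmetic for the box representative and the plane wave -/

/-- [folklore] `(Lc·a + b) mod (N·Lc) = Lc·(a mod N) + b` for `0 ≤ b < Lc`. -/
theorem mul_add_emod_mul (N Lc : ℕ) [NeZero N] [NeZero Lc] (a b : ℤ) (hb0 : 0 ≤ b) (hb : b < Lc) :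
    ((Lc : ℤ) * a + b) % ((N : ℤ) * Lc) = (Lc : ℤ) * (a % N) + b := by
  have hLc : (0 : ℤ) < Lc := by exact_mod_cast Nat.pos_of_ne_zero (NeZero.ne Lc)
  have hN : (0 : ℤ) < N := by exact_mod_cast Nat.pos_of_ne_zero (NeZero.ne N)
  have h1 : ((Lc : ℤ) * a) % ((Lc : ℤ) * N) = (Lc : ℤ) * (a % N) := Int.mul_emod_mul_of_pos a (N : ℤ) hLc
  rw [mul_comm (N : ℤ) (Lc : ℤ), Int.add_emod, h1, Int.emod_eq_of_lt hb0 (lt_of_lt_of_le hb (by nlinarith)), Int.emod_eq_of_lt]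
  · have := Int.emod_nonneg a hN.ne'; positivity
  · have := Int.emod_lt_of_pos a hN; nlinarith

/-- [folklore] **The box representative of the cell point**: `repZ (proj (N·Lc) (Lc•z + r)) = Lc•repZ (proj N z) + r` for `r ∈ box Lc`. -/
theorem repZ_proj_cell {N N' Lc : ℕ} [NeZero N] [NeZero N'] [NeZero Lc] (hN : N' = N * Lc) (z : Site (d + 1))
    {r : Fin (d + 1) → ℕ} (hr : r ∈ box (d + 1) Lc) :
    repZ (Torus.proj N' ((Lc : ℤ) • z + toSite r)) = (Lc : ℤ) • repZ (Torus.proj N z) + toSite r := by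
  funext i
  obtain ⟨h0, hlt⟩ := toSite_mem_range hr i
  simp only [repZ, Literature.Probability.LatticeModels.Torus.proj_apply, Pi.add_apply, Pi.smul_apply, smul_eq_mul,
    ZMod.val_intCast]
  rw [hN]; push_cast
  exact mul_add_emod_mul N Lc (z i) (toSite r i) h0 hlt

/-- [folklore] Plane wave at a dilated site: `pw k (c•x) = pw (c·k) x`. -/
theorem pw_zsmul (k : Fin (d + 1) → ℂ) (c : ℤ) (x : Site (d + 1)) : pw k (c • x) = pw (fun μ => (c : ℂ) * k μ) x := by
  unfold pw
  congr 2
  refine Finset.sum_congr rfl fun μ _ => ?_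
  simp only [Pi.smul_apply, smul_eq_mul, Int.cast_mul]; ring

/-- [folklore] Plane waves are blind to `2π`-integer shifts of the momentum at integer sites. -/
theorem pw_add_two_pi_int (k : Fin (d + 1) → ℂ) (t : Fin (d + 1) → ℤ) (x : Site (d + 1)) :
    pw (fun μ => k μ + 2 * π * (t μ : ℂ)) x = pw k x := by
  unfold pw
  have h : I * ∑ μ, (k μ + 2 * π * (t μ : ℂ)) * (x μ : ℂ) = I * ∑ μ, k μ * (x μ : ℂ) + ((∑ μ, t μ * x μ : ℤ) : ℂ) * (2 * π * I) := by
    push_cast; rw [Finset.mul_sum, Finset.mul_sum, Finset.sum_mul, ← Finset.sum_add_distrib]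
    exact Finset.sum_congr rfl fun μ _ => by ring
  rw [h, Complex.exp_add, Complex.exp_int_mul_two_pi_mul_I, mul_one]

/-- [folklore] **THE FOLDED PLANE WAVE**: the level-`N′` alias `nest N′ N m t` read on the DILATED site `Lc•ζ` is the level-`N` alias `m`
read on `ζ`: `pw (kFine_{N′} p (nest m t)) (Lc•ζ) = pw (kFine_N p m) ζ` (`Lc·k′ = k_m + 2π t`, `AliasNest.natCast_mul_kAl_nest`). -/
theorem pw_kFine_nest_zsmul {N N' Lc : ℕ} [NeZero N] [NeZero N'] [NeZero Lc] (hN : N' = N * Lc) (p : Fin (d + 1) → ℂ)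
    (m : TorusSite (d + 1) N) (t : TorusSite (d + 1) Lc) (ζ : Site (d + 1)) :
    pw (kFine p (nest N' N m t)) ((Lc : ℤ) • ζ) = pw (kFine p m) ζ := by
  rw [pw_zsmul]
  have h : (fun μ => ((Lc : ℤ) : ℂ) * kFine p (nest N' N m t) μ) = fun μ => kFine p m μ + 2 * π * ((((t μ).val : ℤ)) : ℂ) := by
    funext μ
    have := natCast_mul_kAl_nest (D := d + 1) hN p m t μ
    simpa only [Int.cast_natCast] using this
  rw [h, pw_add_two_pi_int]

/-! ## §3 THE CELL SUM AND THE DIFFERENCE SYMBOL IN THE ALIAS FRAME -/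

/-- [folklore] **THE CELL SUM FOLDS THE NEXT LEVEL'S ALIASES ONTO THIS LEVEL'S**: given ANY per-alias expansion of the next level's
column `(F_{N′}⁻¹)_{(κ,ζ),(Q,l)}(p) = Σ_{m′} Amp′(m′, κ)·pw (k′_{m′}) (repZ ζ)` (leaf-16's `FineReadoutColumn.fibInv_inl_inr_eq_sum_Asol`
provides one), the `Lc`-cell sum at the dilated site is a level-`N` alias expansion whose amplitude at `m` is the box-weighted sum over
the `Lc^{d+1}` sub-aliases `nest m t`:
`Σ_{r ∈ box Lc} (F_{N′}⁻¹)_{(κ, Lc•z+r),(Q,l)} = Σ_m [Σ_t boxW Lc (k′_{nest m t})·Amp′(nest m t, κ)]·pw (k_m) (repZ (proj N z))`. -/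
theorem cellSum_eq_sum_fold {N N' Lc : ℕ} [NeZero N] [NeZero N'] [NeZero Lc] (hN : N' = N * Lc) (p : Fin (d + 1) → ℂ)
    (κ l : Fin (d + 1)) (z : Site (d + 1)) (Amp' : TorusSite (d + 1) N' → Fin (d + 1) → ℂ)
    (hexp' : ∀ ζ : TorusSite (d + 1) N',
      fibInv N' (Sum.inl (κ, ζ)) (Sum.inr (Sum.inr l)) p = ∑ m', Amp' m' κ * pw (kFine p m') (repZ ζ)) :
    ∑ r ∈ box (d + 1) Lc, fibInv N' (Sum.inl (κ, Torus.proj N' ((Lc : ℤ) • z + toSite r))) (Sum.inr (Sum.inr l)) p =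
      ∑ m : TorusSite (d + 1) N, (∑ t : TorusSite (d + 1) Lc, boxW Lc (kFine p (nest N' N m t)) * Amp' (nest N' N m t) κ) *
        pw (kFine p m) (repZ (Torus.proj N z)) := by
  -- expand every cell term and split the plane wave
  have h1 : ∀ r ∈ box (d + 1) Lc, fibInv N' (Sum.inl (κ, Torus.proj N' ((Lc : ℤ) • z + toSite r))) (Sum.inr (Sum.inr l)) p =
      ∑ m', Amp' m' κ * pw (kFine p m') ((Lc : ℤ) • repZ (Torus.proj N z)) * pw (kFine p m') (toSite r) := by
    intro r hr
    rw [hexp', repZ_proj_cell hN z hr]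
    exact Finset.sum_congr rfl fun m' _ => by rw [pw_add, mul_assoc]
  rw [Finset.sum_congr rfl h1, Finset.sum_comm]
  -- the r-sum is the box weight
  have h2 : ∀ m' : TorusSite (d + 1) N', ∑ r ∈ box (d + 1) Lc, Amp' m' κ * pw (kFine p m') ((Lc : ℤ) • repZ (Torus.proj N z)) *
      pw (kFine p m') (toSite r) = boxW Lc (kFine p m') * Amp' m' κ * pw (kFine p m') ((Lc : ℤ) • repZ (Torus.proj N z)) := by
    intro m'
    rw [← Finset.mul_sum]; unfold boxW; ring
  rw [Fintype.sum_congr _ _ h2, sum_nest (D := d + 1) hN]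
  refine Finset.sum_congr rfl fun m _ => ?_
  rw [Finset.sum_mul]
  exact Finset.sum_congr rfl fun t _ => by rw [pw_kFine_nest_zsmul hN]

/-- [folklore] **THE DIFFERENCE SYMBOL IN THE ALIAS FRAME** (the owner's §3(b) made literal): with per-alias expansions at the two levels,
`diffSym N N′ Lc κ l z p = Σ_{m ∈ (ℤ/N)^{d+1}} [ (Lc^{d+1})⁻¹·N′^{d+2}·Σ_{t ∈ (ℤ/Lc)^{d+1}} boxW Lc (k′_{nest m t})·Amp′(nest m t, κ)
  − N^{d+2}·Amp(m, κ) ]·pw (k_m) (repZ (proj N z))` — the comparison is ALIAS BY ALIAS at level `N`. -/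
theorem diffSym_eq_sum_fold {N N' Lc : ℕ} [NeZero N] [NeZero N'] [NeZero Lc] (hN : N' = N * Lc) (p : Fin (d + 1) → ℂ)
    (κ l : Fin (d + 1)) (z : Site (d + 1)) (Amp : TorusSite (d + 1) N → Fin (d + 1) → ℂ)
    (Amp' : TorusSite (d + 1) N' → Fin (d + 1) → ℂ)
    (hexp : ∀ ζ : TorusSite (d + 1) N,
      fibInv N (Sum.inl (κ, ζ)) (Sum.inr (Sum.inr l)) p = ∑ m, Amp m κ * pw (kFine p m) (repZ ζ))
    (hexp' : ∀ ζ : TorusSite (d + 1) N',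
      fibInv N' (Sum.inl (κ, ζ)) (Sum.inr (Sum.inr l)) p = ∑ m', Amp' m' κ * pw (kFine p m') (repZ ζ)) :
    diffSym N N' Lc κ l z p =
      ∑ m : TorusSite (d + 1) N,
        ((((Lc : ℂ) ^ (d + 1))⁻¹ * ((N' : ℂ) ^ (d + 2)) *
            ∑ t : TorusSite (d + 1) Lc, boxW Lc (kFine p (nest N' N m t)) * Amp' (nest N' N m t) κ) -
          ((N : ℂ) ^ (d + 2)) * Amp m κ) * pw (kFine p m) (repZ (Torus.proj N z)) := by
  unfold diffSym
  rw [cellSum_eq_sum_fold hN p κ l z Amp' hexp', hexp (Torus.proj N z), Finset.mul_sum, Finset.mul_sum, ← Finset.sum_sub_distrib]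
  exact Finset.sum_congr rfl fun m _ => by ring

/-! ## §4 KEY STRUCTURE of the sub-alias box weights: `gs (k′_i) Lc · dhat k′ i = dhat k_m i` -/

/-- [folklore] **THE SUB-ALIAS BOX FACTOR AGAINST THE FORWARD SYMBOL**: for the sub-alias `nest m t` of the level-`N` alias `m`,
`gs (k′_i) Lc · (e^{i k′_i} − 1) = e^{i k_{m,i}} − 1` (`Lc·k′ = k_m + 2π t`): in a coordinate with `t_i = 0` the box factor is the matched
weight (`≈ Lc` for small `k_m`), in a coordinate with `t_i ≠ 0` it is `dhat(k_m)_i / dhat(k′)_i = O(|k_{m,i}|)` — ONE derivative gained. -/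
theorem gs_kFine_nest_mul_dhat {N N' Lc : ℕ} [NeZero N] [NeZero N'] [NeZero Lc] (hN : N' = N * Lc) (p : Fin (d + 1) → ℂ)
    (m : TorusSite (d + 1) N) (t : TorusSite (d + 1) Lc) (i : Fin (d + 1)) :
    gs (kFine p (nest N' N m t) i) Lc * dhat (kFine p (nest N' N m t)) i = dhat (kFine p m) i := by
  unfold dhat gs
  rw [geomExp_mul_sub_one]
  have h := natCast_mul_kAl_nest (D := d + 1) hN p m t i
  have h2 : I * kFine p (nest N' N m t) i * (Lc : ℂ) = I * kFine p m i + (((t i).val : ℤ) : ℂ) * (2 * π * I) := by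
    rw [mul_assoc, mul_comm (kFine p _ i), show (Lc : ℂ) * kFine p (nest N' N m t) i = kAl N p m i + 2 * π * (((t i).val : ℤ) : ℂ)
      from h]
    simp only [kAl]; ring
  rw [h2, Complex.exp_add, Complex.exp_int_mul_two_pi_mul_I, mul_one]

/-- [folklore] Hence the full box weight of a sub-alias against the product of its forward symbols:
`boxW Lc k′ · Π_i dhat k′ i = Π_i dhat k_m i`. -/
theorem boxW_nest_mul_prod_dhat {N N' Lc : ℕ} [NeZero N] [NeZero N'] [NeZero Lc] (hN : N' = N * Lc) (p : Fin (d + 1) → ℂ)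
    (m : TorusSite (d + 1) N) (t : TorusSite (d + 1) Lc) :
    boxW Lc (kFine p (nest N' N m t)) * ∏ i, dhat (kFine p (nest N' N m t)) i = ∏ i, dhat (kFine p m) i := by
  rw [boxW_eq_prod, ← Finset.prod_mul_distrib]
  exact Finset.prod_congr rfl fun i _ => gs_kFine_nest_mul_dhat hN p m t i

end Summit.QuantumFields.BalabanUV.Beta.GAN24.FineReadoutCauchyFold

end
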